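import Literature.NumberTheory.EllipticCurves.Kato2004.IwasawaCohomologyNumberFieldTwistSum
import HarnessLib

/-!
# The cross terms of Shapiro's decomposition for a quadratic-twist pair: `cor^A ∘ res^A = [Γ_ℚ : galRange K]`, `res^A ∘ cor^A ∘ res = 0`,
# `res ∘ cor ∘ res^A = 0`, `cor ∘ res^A = 0`, `cor^A ∘ res = 0`; INJECTIVITY of `res ⊕ res^A` on torsion-free carriers, and of
# `loc_W ⊕ 𝐇¹(u_v) loc_A` given injectivity of `loc_w̄` on `𝐇¹_{K,Γ}`

Topic `NumberTheory/EllipticCurves/Kato2004` (namespace = path).  Seat `bsd-2adic-conv-1` GEN 31 (cell `pub/bsd-2adic`), item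
stmt-BirchSwinnertonDyer-19556 `OrdLambdaHalfAtTwo`, line `kato_determinant_greenberg_two`, stub 4‴ / the (PT) binder
`TwoAdicShapiroPT.ShapiroLatticePoitouTateAtTwoTheta`, conjunct (4) `loc_injective`: the compact-side map
`loc_W ⊕ 𝐇¹(u_v)∘loc_A : 𝐇¹_Γ(T_pW) ⊕ 𝐇¹_Γ(T_pA) → 𝐇¹_loc(T_pW)` FACTORS through the `K`-level carrier as `loc_w̄ ∘ (res ⊕ res^A)`
(`locOver_resOver`, `locOver_resOverTwist`, files `…Loc` / `…TwistSum`); this file proves that `res ⊕ res^A` is INJECTIVE when the two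
`ℚ`-side carriers are `Λ`-torsion free (Kato Thm 12.4 (2), tree named fact `thm12_4`) and `[Γ_ℚ : galRange K] = 2`, so that conjunct (4) reduces to
the single printed statement «`loc_w̄` is injective on `H¹_Iw(K_Σ/K, T_pW)` when the BDP Selmer group is `Λ`-cotorsion» (Greenberg 2010 Prop 3.1.1).

THEOREMS ONLY (no definition, no named fact, no instance).  The algebra: with `N = [Γ_ℚ : galRange K]` (`= 2` for the quadratic field of a twist)
`cor ∘ res = N` (`corOver_resOver`), `cor^A ∘ res^A = N` (HERE: `coresLe_resLe` through the model and `u⁻¹_* u_* = id`), and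
`res cor + res^A cor^A = 2` (`resOver_corOver_add_resOverTwist_corOverTwist`); evaluating the last identity on `res x` and on `res^A y` gives the
vanishing of the cross terms after `res`, resp. `res^A`; injectivity of `res`, `res^A` (from `cor ∘ res = 2` on a `2`-torsion-free module) removes
them.  Nothing about elliptic curves beyond the carriers' axioms is used; BSD is not proved by any of this.

References: [NeukirchSchmidtWingberg2008] I §5 Prop. 1.5.3 (iv), (1.5.6)–(1.5.7) (cor ∘ res = index; res ∘ cor = norm); [GreenbergLNM1716] §4
p. 107 (`2E(K) ⊆ E(ℚ) + E^K(ℚ)`); [Rubin2000] App. B §3; [Greenberg2010] Prop. 3.1.1 (the consumer's remaining input).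
-/

noncomputable section

open scoped NumberField
open Field IsDedekindDomain WeierstrassCurve CategoryTheory
open Literature.NumberTheory.GaloisRepresentations
open Literature.NumberTheory.EllipticCurves Literature.NumberTheory.EllipticCurves.Kato2004.EulerSystemValues

namespace Literature.NumberTheory.EllipticCurves.Kato2004

/-! ## §1 Levelwise: `cor^A_n ∘ res^A_n = [U_n : V_n]` -/

section Sum

variable (K : Type) [Field K] [NumberField K] {p : ℕ} [Fact p.Prime] (κ : ZpExtension ℚ p)
  (h : Function.Surjective (κ.toContinuousMonoidHom.comp (absGaloisRestrict ℚ K)))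
  (W : WeierstrassCurve ℚ) [W.IsElliptic] [ContinuousSMul ℤ_[p] (W.tateModule p)]
  [ContinuousSMul ℤ_[p] ((W.baseChange K).tateModule p)]
  (A' : WeierstrassCurve ℚ) [A'.IsElliptic] [ContinuousSMul ℤ_[p] (A'.tateModule p)]
  (u : A'.tateModule p ≃ₗ[ℤ_[p]] W.tateModule p) (hu : Continuous u) (hu' : Continuous u.symm)
  (hu₁ : ∀ σ : absoluteGaloisGroup ℚ, σ ∈ galRange (K := ℚ) K → ∀ x : A'.tateModule p, u (σ • x) = σ • u x)

/-- **`cor^A_n (res^A_n y) = [U_n : V_n] • y` on `H¹(ℚ_n, T_pA)`** (`cor^A_n = cor_{U/V} ∘ u⁻¹_* ∘ M_n`, `res^A_n = N_n ∘ u_* ∘ res_{V/U}`,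
`M_n ∘ N_n = id`, `u⁻¹_* ∘ u_* = id`, `cor ∘ res = index`). [cite: NeukirchSchmidtWingberg2008, I §5 Prop. 1.5.3 (iv)] -/
theorem layerCorTwist_layerResTwist (n : ℕ) [Fintype (κ.layerSubgroup n ⧸ (layerGalRange K κ n).subgroupOf (κ.layerSubgroup n))]
    (y : H1 (tateRep A' p) (κ.layerSubgroup n)) :
    layerCorTwist K κ h W A' u hu' hu₁ n (layerResTwist K κ h W A' u hu hu₁ n y) =
      (((layerGalRange K κ n).subgroupOf (κ.layerSubgroup n)).index : ℤ_[p]) • y := by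
  rw [layerCorTwist_apply, layerResTwist_apply, layerToGalRange_layerOfGalRange, layerUntwist_layerTwist, coresLe_resLe]

end Sum

/-! ## §2 Carriers: `cor^A ∘ res^A = [Γ_ℚ : galRange K]`, the cross terms, injectivity -/

section Carriers

variable {K : Type} [Field K] [NumberField K] {p : ℕ} [Fact p.Prime] {κ : ZpExtension ℚ p}
  {h : Function.Surjective (κ.toContinuousMonoidHom.comp (absGaloisRestrict ℚ K))}
  {W : WeierstrassCurve ℚ} [W.IsElliptic] [ContinuousSMul ℤ_[p] (W.tateModule p)]
  [ContinuousSMul ℤ_[p] ((W.baseChange K).tateModule p)]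
  {A' : WeierstrassCurve ℚ} [A'.IsElliptic] [ContinuousSMul ℤ_[p] (A'.tateModule p)]
  (u : A'.tateModule p ≃ₗ[ℤ_[p]] W.tateModule p) (hu : Continuous u) (hu' : Continuous u.symm)
  (hu₁ : ∀ σ : absoluteGaloisGroup ℚ, σ ∈ galRange (K := ℚ) K → ∀ x : A'.tateModule p, u (σ • x) = σ • u x)
  (hu₂ : ∀ σ : absoluteGaloisGroup ℚ, σ ∉ galRange (K := ℚ) K → ∀ x : A'.tateModule p, u (σ • x) = -(σ • u x))
  {γ : absoluteGaloisGroup ℚ} {γK : absoluteGaloisGroup K}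
  (I : IwasawaH1Data W p κ γ) (I_A : IwasawaH1Data A' p κ γ) (IK : IwasawaH1DataOver (W.baseChange K) p (κ.restrict K h) γK)

namespace IwasawaH1DataOver

/-- **`cor^A ∘ res^A = [Γ_ℚ : galRange K]` on `𝐇¹_Γ(T_pA)`** (for `K/ℚ` Galois; `= 2` for the quadratic field of a twist) — the twisted analogue of
`corOver_resOver`. [cite: NeukirchSchmidtWingberg2008, I §5 Prop. 1.5.3 (iv)] [cite: Rubin2000, App. B §3] -/
theorem corOverTwist_resOverTwist [(galRange (K := ℚ) K).Normal] (hγ : κ.IsTopGenerator γ) (hγK : (κ.restrict K h).IsTopGenerator γK)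
    (y : I_A.H) :
    IK.corOverTwist u hu' hu₁ I_A hγK hγ (I_A.resOverTwist u hu hu₁ IK hγ hγK y) = (galRange (K := ℚ) K).index • y := by
  refine I_A.ext_of_proj fun n ↦ ?_
  haveI := finite_quotient_layerGalRange K κ n
  letI : Fintype (κ.layerSubgroup n ⧸ (layerGalRange K κ n).subgroupOf (κ.layerSubgroup n)) := Fintype.ofFinite _
  rw [proj_corOverTwist, IwasawaH1Data.proj_resOverTwist, layerCorTwist_layerResTwist, index_subgroupOf_layerGalRange K κ h n, map_nsmul,
    Nat.cast_smul_eq_nsmul]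

include hu' hu₂ in
/-- **`res^A (cor^A (res x)) = 0`** when `[Γ_ℚ : galRange K] = 2`: evaluate `res cor + res^A cor^A = 2` at `res x` and use `cor (res x) = 2x`.
[cite: NeukirchSchmidtWingberg2008, I §5 (1.5.6)–(1.5.7)] [cite: GreenbergLNM1716, §4 p. 107] -/
theorem resOverTwist_corOverTwist_resOver [(galRange (K := ℚ) K).Normal] (hK2 : (galRange (K := ℚ) K).index = 2)
    (hγ : κ.IsTopGenerator γ) (hγK : (κ.restrict K h).IsTopGenerator γK) (x : I.H) :
    I_A.resOverTwist u hu hu₁ IK hγ hγK (IK.corOverTwist u hu' hu₁ I_A hγK hγ (I.resOver IK hγ hγK x)) = 0 := by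
  have hsum := IK.resOver_corOver_add_resOverTwist_corOverTwist u hu hu' hu₁ hu₂ I I_A hγ hγK (I.resOver IK hγ hγK x)
  rw [IK.corOver_resOver I hγ hγK x, hK2, map_nsmul] at hsum
  exact add_eq_left.mp hsum

include hu' hu₂ in
/-- **`res (cor (res^A y)) = 0`** when `[Γ_ℚ : galRange K] = 2`: evaluate `res cor + res^A cor^A = 2` at `res^A y` and use `cor^A (res^A y) = 2y`.
[cite: NeukirchSchmidtWingberg2008, I §5 (1.5.6)–(1.5.7)] [cite: GreenbergLNM1716, §4 p. 107] -/
theorem resOver_corOver_resOverTwist [(galRange (K := ℚ) K).Normal] (hK2 : (galRange (K := ℚ) K).index = 2)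
    (hγ : κ.IsTopGenerator γ) (hγK : (κ.restrict K h).IsTopGenerator γK) (y : I_A.H) :
    I.resOver IK hγ hγK (IK.corOver I hγK hγ (I_A.resOverTwist u hu hu₁ IK hγ hγK y)) = 0 := by
  have hsum := IK.resOver_corOver_add_resOverTwist_corOverTwist u hu hu' hu₁ hu₂ I I_A hγ hγK (I_A.resOverTwist u hu hu₁ IK hγ hγK y)
  rw [IK.corOverTwist_resOverTwist u hu hu' hu₁ I_A hγ hγK y, hK2, map_nsmul] at hsum
  exact add_eq_right.mp hsum

/-- A `Λ`-module that is torsion free has no `2`-torsion: `(2 : ℕ) • x = 0 → x = 0`. [cite: Kato2004Asterisque, Thm 12.4 (2) (p. 221)] -/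
theorem eq_zero_of_two_nsmul_eq_zero {M : Type*} [AddCommGroup M] [Module (IwasawaAlgebra p) M] [Module.IsTorsionFree (IwasawaAlgebra p) M]
    {x : M} (hx : (2 : ℕ) • x = 0) : x = 0 := by
  have h2 : ((2 : ℕ) : IwasawaAlgebra p) ≠ 0 := by
    rw [← map_natCast (PowerSeries.C (R := ℤ_[p])) 2]
    exact (map_ne_zero_iff _ PowerSeries.C_injective).2 (by norm_num)
  have hreg : IsSMulRegular M ((2 : ℕ) : IwasawaAlgebra p) := (IsRegular.of_ne_zero h2).isSMulRegular
  refine hreg (?_ : ((2 : ℕ) : IwasawaAlgebra p) • x = ((2 : ℕ) : IwasawaAlgebra p) • (0 : M))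
  rw [Nat.cast_smul_eq_nsmul, hx, smul_zero]

/-- **`res` is injective on a torsion-free `𝐇¹_Γ(T_pW)`** when `[Γ_ℚ : galRange K] = 2` (`cor ∘ res = 2`). [cite: NeukirchSchmidtWingberg2008, I §5 Prop. 1.5.3 (iv)] -/
theorem resOver_injective [(galRange (K := ℚ) K).Normal] [Module.IsTorsionFree (IwasawaAlgebra p) I.H]
    (hK2 : (galRange (K := ℚ) K).index = 2) (hγ : κ.IsTopGenerator γ) (hγK : (κ.restrict K h).IsTopGenerator γK) :
    Function.Injective (I.resOver IK hγ hγK) := by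
  refine (injective_iff_map_eq_zero _).mpr fun x hx ↦ eq_zero_of_two_nsmul_eq_zero (p := p) ?_
  rw [← hK2, ← IK.corOver_resOver I hγ hγK x, hx, map_zero]

include hu' in
/-- **`res^A` is injective on a torsion-free `𝐇¹_Γ(T_pA)`** when `[Γ_ℚ : galRange K] = 2` (`cor^A ∘ res^A = 2`).
[cite: NeukirchSchmidtWingberg2008, I §5 Prop. 1.5.3 (iv)] -/
theorem resOverTwist_injective [(galRange (K := ℚ) K).Normal] [Module.IsTorsionFree (IwasawaAlgebra p) I_A.H]
    (hK2 : (galRange (K := ℚ) K).index = 2) (hγ : κ.IsTopGenerator γ) (hγK : (κ.restrict K h).IsTopGenerator γK) :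
    Function.Injective (I_A.resOverTwist u hu hu₁ IK hγ hγK) := by
  refine (injective_iff_map_eq_zero _).mpr fun y hy ↦ eq_zero_of_two_nsmul_eq_zero (p := p) ?_
  rw [← hK2, ← IK.corOverTwist_resOverTwist u hu hu' hu₁ I_A hγ hγK y, hy, map_zero]

include hu' hu₂ in
/-- **`cor (res^A y) = 0`** (torsion-free `𝐇¹_Γ(T_pW)`, index `2`): the twisted classes are killed by the corestriction to `ℚ`.
[cite: GreenbergLNM1716, §4 p. 107] [cite: NeukirchSchmidtWingberg2008, I §5 (1.5.6)–(1.5.7)] -/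
theorem corOver_resOverTwist [(galRange (K := ℚ) K).Normal] [Module.IsTorsionFree (IwasawaAlgebra p) I.H]
    (hK2 : (galRange (K := ℚ) K).index = 2) (hγ : κ.IsTopGenerator γ) (hγK : (κ.restrict K h).IsTopGenerator γK) (y : I_A.H) :
    IK.corOver I hγK hγ (I_A.resOverTwist u hu hu₁ IK hγ hγK y) = 0 :=
  resOver_injective I IK hK2 hγ hγK (by rw [IK.resOver_corOver_resOverTwist u hu hu' hu₁ hu₂ I I_A hK2 hγ hγK, map_zero])

include hu hu₂ in
/-- **`cor^A (res x) = 0`** (torsion-free `𝐇¹_Γ(T_pA)`, index `2`). [cite: GreenbergLNM1716, §4 p. 107] [cite: NeukirchSchmidtWingberg2008, I §5 (1.5.6)–(1.5.7)] -/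
theorem corOverTwist_resOver [(galRange (K := ℚ) K).Normal] [Module.IsTorsionFree (IwasawaAlgebra p) I_A.H]
    (hK2 : (galRange (K := ℚ) K).index = 2) (hγ : κ.IsTopGenerator γ) (hγK : (κ.restrict K h).IsTopGenerator γK) (x : I.H) :
    IK.corOverTwist u hu' hu₁ I_A hγK hγ (I.resOver IK hγ hγK x) = 0 :=
  resOverTwist_injective u hu hu' hu₁ I_A IK hK2 hγ hγK
    (by rw [IK.resOverTwist_corOverTwist_resOver u hu hu' hu₁ hu₂ I I_A hK2 hγ hγK, map_zero])

include hu' hu₂ in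
/-- **`res ⊕ res^A : 𝐇¹_Γ(T_pW) ⊕ 𝐇¹_Γ(T_pA) → 𝐇¹_{K,Γ}(T_pW_K)` is INJECTIVE** for torsion-free carriers and `[Γ_ℚ : galRange K] = 2`: if
`res x + res^A y = 0`, apply `cor` (`2x + 0 = 0`) and `cor^A` (`0 + 2y = 0`).  (Shapiro: `𝐇¹_Γ(T_pW) ≅ H⁺`, `𝐇¹_Γ(T_pA) ≅ H⁻`, `H⁺ ∩ H⁻ = H[2] = 0`.)
[cite: GreenbergLNM1716, §4 p. 107] [cite: Kato2004Asterisque, §17.13 (17.13.2) (p. 279)] -/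
theorem eq_zero_of_resOver_add_resOverTwist_eq_zero [(galRange (K := ℚ) K).Normal] [Module.IsTorsionFree (IwasawaAlgebra p) I.H]
    [Module.IsTorsionFree (IwasawaAlgebra p) I_A.H] (hK2 : (galRange (K := ℚ) K).index = 2)
    (hγ : κ.IsTopGenerator γ) (hγK : (κ.restrict K h).IsTopGenerator γK) {x : I.H} {y : I_A.H}
    (hxy : I.resOver IK hγ hγK x + I_A.resOverTwist u hu hu₁ IK hγ hγK y = 0) : x = 0 ∧ y = 0 := by
  constructor
  · apply eq_zero_of_two_nsmul_eq_zero (p := p)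
    have := congrArg (IK.corOver I hγK hγ) hxy
    rwa [map_add, IK.corOver_resOver I hγ hγK, IK.corOver_resOverTwist u hu hu' hu₁ hu₂ I I_A hK2 hγ hγK, add_zero, map_zero, hK2] at this
  · apply eq_zero_of_two_nsmul_eq_zero (p := p)
    have := congrArg (IK.corOverTwist u hu' hu₁ I_A hγK hγ) hxy
    rwa [map_add, IK.corOverTwist_resOver u hu hu' hu₁ hu₂ I I_A hK2 hγ hγK, IK.corOverTwist_resOverTwist u hu hu' hu₁ I_A hγ hγK, zero_add,
      map_zero, hK2] at this

end IwasawaH1DataOver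

end Carriers

/-! ## §3 `loc_W ⊕ 𝐇¹(u_v) loc_A` is injective as soon as `loc_w̄` is injective on `𝐇¹_{K,Γ}` -/

section Loc

variable {K : Type} [Field K] [NumberField K] {p : ℕ} [Fact p.Prime] {κ : ZpExtension ℚ p}
  {h : Function.Surjective (κ.toContinuousMonoidHom.comp (absGaloisRestrict ℚ K))}
  {v : HeightOneSpectrum (𝓞 ℚ)}
  {hD : ∀ g : absoluteGaloisGroup (v.adicCompletion ℚ),
    resGalOfEmb (closureEmb (K := ℚ) (v.adicCompletion ℚ)) g ∈ galRange (K := ℚ) K}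
  {W : WeierstrassCurve ℚ} [W.IsElliptic] [ContinuousSMul ℤ_[p] (W.tateModule p)]
  [ContinuousSMul ℤ_[p] ((W.baseChange K).tateModule p)]
  {A' : WeierstrassCurve ℚ} [A'.IsElliptic] [ContinuousSMul ℤ_[p] (A'.tateModule p)]
  (u : A'.tateModule p ≃ₗ[ℤ_[p]] W.tateModule p) (hu : Continuous u) (hu' : Continuous u.symm)
  (hu₁ : ∀ σ : absoluteGaloisGroup ℚ, σ ∈ galRange (K := ℚ) K → ∀ x : A'.tateModule p, u (σ • x) = σ • u x)
  (hu₂ : ∀ σ : absoluteGaloisGroup ℚ, σ ∉ galRange (K := ℚ) K → ∀ x : A'.tateModule p, u (σ • x) = -(σ • u x))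
  {γ : absoluteGaloisGroup ℚ} {γK : absoluteGaloisGroup K} {γᵥ : absoluteGaloisGroup (v.adicCompletion ℚ)}
  (I : IwasawaH1Data W p κ γ) (I_A : IwasawaH1Data A' p κ γ) (IK : IwasawaH1DataOver (W.baseChange K) p (κ.restrict K h) γK)
  (J : LocalIwasawaH1Data κ v ((tateRep W p).toLocal v) γᵥ) (J_A : LocalIwasawaH1Data κ v ((tateRep A' p).toLocal v) γᵥ)

namespace IwasawaH1DataOver

/-- **`loc_W ⊕ 𝐇¹(u_v)∘loc_A = loc_w̄ ∘ (res ⊕ res^A)`** on the pinned carriers (`locOver_resOver`, `locOver_resOverTwist`).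
[cite: Kato2004Asterisque, §17.13 (17.13.1) (p. 279)] -/
theorem coprod_loc_eq_locOver [(galRange (K := ℚ) K).Normal]
    (hsurjv : Function.Surjective
      (κ.toContinuousMonoidHom.comp (resGalOfEmb (closureEmb (K := ℚ) (v.adicCompletion ℚ)))))
    (hγ : κ.IsTopGenerator γ) (hγK : (κ.restrict K h).IsTopGenerator γK)
    (hγᵥ : κ.IsTopGenerator (resGalOfEmb (closureEmb (K := ℚ) (v.adicCompletion ℚ)) γᵥ)) (x : I.H) (y : I_A.H) :
    (I.loc J hsurjv hγ hγᵥ).coprod (J_A.map (localTwistHom v hD W A' u hu hu₁) J ∘ₗ I_A.loc J_A hsurjv hγ hγᵥ) (x, y) =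
      IK.locOver J hD hsurjv hγK hγᵥ (I.resOver IK hγ hγK x + I_A.resOverTwist u hu hu₁ IK hγ hγK y) := by
  rw [LinearMap.coprod_apply, LinearMap.comp_apply, map_add, IK.locOver_resOver J I hD hsurjv hγ hγK hγᵥ,
    IK.locOver_resOverTwist u hu hu₁ I_A J J_A hsurjv hγ hγK hγᵥ]

include hu' hu₂ in
/-- **Conjunct (4) of the crux-19556 (PT) binder from ONE input: if `loc_w̄` is injective on `𝐇¹_{K,Γ}(T_pW_K)`, then
`loc_W ⊕ 𝐇¹(u_v)∘loc_A` is injective** (torsion-free `ℚ`-side carriers — Kato Thm 12.4 (2) —, `[Γ_ℚ : galRange K] = 2`, `v` split).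
The remaining input is Greenberg's «the compact Selmer group of the dual structure vanishes under cotorsion». [cite: Greenberg2010, Prop. 3.1.1]
[cite: Kato2004Asterisque, §17.13 (17.13.2) (p. 279)] -/
theorem coprod_loc_injective_of_locOver_injective [(galRange (K := ℚ) K).Normal] [Module.IsTorsionFree (IwasawaAlgebra p) I.H]
    [Module.IsTorsionFree (IwasawaAlgebra p) I_A.H] (hK2 : (galRange (K := ℚ) K).index = 2)
    (hsurjv : Function.Surjective
      (κ.toContinuousMonoidHom.comp (resGalOfEmb (closureEmb (K := ℚ) (v.adicCompletion ℚ)))))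
    (hγ : κ.IsTopGenerator γ) (hγK : (κ.restrict K h).IsTopGenerator γK)
    (hγᵥ : κ.IsTopGenerator (resGalOfEmb (closureEmb (K := ℚ) (v.adicCompletion ℚ)) γᵥ))
    (hloc : Function.Injective (IK.locOver J hD hsurjv hγK hγᵥ)) :
    Function.Injective
      ((I.loc J hsurjv hγ hγᵥ).coprod (J_A.map (localTwistHom v hD W A' u hu hu₁) J ∘ₗ I_A.loc J_A hsurjv hγ hγᵥ)) := by
  refine (injective_iff_map_eq_zero _).mpr fun xy hxy ↦ ?_
  obtain ⟨x, y⟩ := xy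
  rw [IK.coprod_loc_eq_locOver u hu hu₁ I I_A J J_A hsurjv hγ hγK hγᵥ, ← map_zero (IK.locOver J hD hsurjv hγK hγᵥ)] at hxy
  obtain ⟨rfl, rfl⟩ := IK.eq_zero_of_resOver_add_resOverTwist_eq_zero u hu hu' hu₁ hu₂ I I_A hK2 hγ hγK (hloc hxy)
  rfl

end IwasawaH1DataOver

end Loc

end Literature.NumberTheory.EllipticCurves.Kato2004

end
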